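import Summits.Ventures.GridStability.Models.LossyNumericalRangeSpectrum

/-!
# GridStability/Models/LossyNumericalRangeSwing — the robust lossy lane on the classical model / common-filter droop microgrid: DEFLATION of the synchronous mode + numerical-range certificates

Cell `gridfusion` (LADDER-GRIDFUSION, APEX LINE «inverter-dominated networks», rung G3 / row family «G3-ss»;
seat gridfusion-model-3 (g6)). Model-side wrappers of `Models/LossyNumericalRangeSpectrum.lean`
(`re_eig_gt_of_numRange`, `im_eig_le_of_numRange`, `quadratic_re_lt_neg_of_region`), with one more
height lever: the synchronous mode is removed by BRAUER DEFLATION instead of the exact left null vector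
(whose rational height grows like `n`·data height — 868 digits at `n = 10`):
* §0 `exists_eig_deflate` ([folklore], Brauer's eigenvalue shift): `A` real with zero row sums (`A 1 = 0`),
  `z` any real vector, `γ = Σ z_j`; every complex eigenpair `A x = μ x`, `x ≠ 0`, with `μ ≠ 0`, `μ ≠ γ` yields
  an eigenpair of the DEFLATED matrix `A + 1 zᵀ` for the SAME `μ` (eigenvector `x + (zᵀx/(μ − γ))·1`). So
  certificates about `A + 1 zᵀ` (whose spectrum is `{γ} ∪ spec(A) ∖ {0}`, no zero mode, no `w`) bound every
  non-synchronous mode of `A`; `z` is free data of small height (e.g. `γ/n · 1`).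
* §1 `ClassicalSwing.eig_re_lt_neg_of_deflate` — uniform damping ratio `D_i = d·M_i` (`M_i > 0`), ANY `G`,
  `B` (transfer conductances kept, complex pencil eigenvalues admitted): with `A₊ = M⁻¹L(δ) + 1 zᵀ`,
  `ν₀ < Σ z_j`, `S ≻ 0`, `S A₊ + (S A₊)ᵀ − 2ν₀·S ≻ 0`, `[[2κ·S, K], [Kᵀ, 2κ·S]] ⪰ 0` (`K = S A₊ − (S A₊)ᵀ`),
  `d > 2r`, `κ² ≤ (d − 2r)²·(ν₀ + r² − d r)` ⇒ every complex eigenpair of `J(δ)` is synchronous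
  (`L(δ) x = 0`) or has `Re z < −r`; `ClassicalSwing.PeJac_ker_const_of_deflate` — the same real-part
  certificate with `ν₀ ≥ 0`, `Σ z_j ≠ 0` makes the synchronous mode the uniform angle shift;
* §2 `DroopMicrogrid.eig_re_lt_neg_of_commonFilter_deflate` — the reading on the frozen-voltage droop
  microgrid with a COMMON power-filter time constant `τ` (`d = 1/τ`) and LOSSY Kron-reduced lines.
COST per instance: PSD checks of sizes `n`, `n`, `2n` over rationals of data height (integer Gram route);
no left null vector, no exact symmetrizer. THREE COLUMNS. CERTIFIED (kernel, once instantiated): statements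
about the MATRIX `J(δ)`; nothing about the nonlinear flow. MODELLED: MV-2 (lossy Kron reduction KEPT) + MV-λ
[cite: SauerPai1998, §6.10]; droop reading MV-6N [cite: KunduEtAl2019, eqs. (4a)–(4b), (5a)]
[cite: SchifferEtAl2014, Remark 3.3]. No parameter values. No sentence of this file says a converter, a
microgrid or a grid is stable.
-/

noncomputable section

open Real Matrix Finset
open scoped ComplexOrder ComplexConjugate

namespace Summit.Ventures.GridStability.Models

/-! ## §0 Brauer deflation of the zero mode -/

section Deflate

variable {ι : Type*} [Fintype ι] [DecidableEq ι]

omit [DecidableEq ι] in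
/-- **Brauer deflation of the synchronous mode.** `A` real with zero row sums, `z` real, `γ = Σ_j z_j`:
an eigenpair `A x = μ x`, `x ≠ 0`, with `μ ≠ 0` and `μ ≠ γ` gives an eigenpair of `A + 1 zᵀ` for the same
`μ`, with eigenvector `x + α·1`, `α = zᵀx/(μ − γ)`. [folklore] -/
theorem exists_eig_deflate {A : Matrix ι ι ℝ} (hrow : ∀ i, ∑ j, A i j = 0) (z : ι → ℝ) {μ : ℂ}
    {x : ι → ℂ} (hx : x ≠ 0) (hAx : A.map ((↑) : ℝ → ℂ) *ᵥ x = μ • x) (hμ0 : μ ≠ 0)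
    (hμγ : μ ≠ ((∑ j, z j : ℝ) : ℂ)) :
    ∃ x' : ι → ℂ, x' ≠ 0 ∧
      (A + Matrix.vecMulVec (fun _ => (1 : ℝ)) z).map ((↑) : ℝ → ℂ) *ᵥ x' = μ • x' := by
  set γ : ℂ := ((∑ j, z j : ℝ) : ℂ) with hγdef
  set t : ℂ := ∑ j, (z j : ℂ) * x j with htdef
  have hμγ' : μ - γ ≠ 0 := sub_ne_zero.2 hμγ
  set α : ℂ := t / (μ - γ) with hαdef
  refine ⟨fun i => x i + α, ?_, ?_⟩
  · -- x + α·1 ≠ 0: otherwise x is constant, `A x = 0`, `μ = 0`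
    intro h0
    have hxc : x = fun _ => -α := by
      funext i
      have := congr_fun h0 i
      simp only [Pi.zero_apply] at this
      linear_combination this
    have hA0 : A.map ((↑) : ℝ → ℂ) *ᵥ x = 0 := by
      rw [hxc]; exact mulVec_const_eq_zero_of_rowsum hrow _
    rw [hA0] at hAx
    have : μ • x = 0 := hAx.symm
    rcases smul_eq_zero.1 this with h | h
    · exact hμ0 h
    · exact hx h
  · have hAxi : ∀ i, (A.map ((↑) : ℝ → ℂ) *ᵥ x) i = μ * x i := fun i => by
      simpa using congr_fun hAx i
    have hγsum : (∑ j, (z j : ℂ)) = γ := by rw [hγdef]; push_cast; rfl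
    have hkey : t + α * γ = μ * α := by
      rw [hαdef]
      field_simp
      ring
    funext i
    rw [map_ofReal_mulVec_apply]
    simp only [Matrix.add_apply, Matrix.vecMulVec_apply, one_mul, Pi.smul_apply, smul_eq_mul]
    push_cast
    have h1 : ∑ j, ((A i j : ℂ) + (z j : ℂ)) * (x j + α)
        = (∑ j, (A i j : ℂ) * x j) + α * (∑ j, (A i j : ℂ)) + t + α * ∑ j, (z j : ℂ) := by
      rw [htdef, Finset.mul_sum, Finset.mul_sum, ← Finset.sum_add_distrib, ← Finset.sum_add_distrib,
        ← Finset.sum_add_distrib]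
      refine Finset.sum_congr rfl fun j _ => ?_
      ring
    have h2 : (∑ j, (A i j : ℂ) * x j) = μ * x i := by
      rw [← hAxi i, map_ofReal_mulVec_apply]
    have h3 : (∑ j, (A i j : ℂ)) = 0 := by exact_mod_cast hrow i
    rw [h1, h2, h3, hγsum, mul_zero, add_zero, add_assoc, hkey]
    ring

/-- **Real part of the WHOLE spectrum, no left null vector** (the point-certificate form): `S ≻ 0` and
`S A + (S A)ᵀ − 2ν₀·S ≻ 0` ⇒ every complex eigenpair `A x = μ x`, `x ≠ 0`, has `Re μ > ν₀` — also for
`μ = 0` (apply `re_eig_gt_of_numRange` with `w = 0` to the shifted matrix `A + 1`, whose certificate matrix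
at level `ν₀ + 1` is the same `H`). Used for reduced Jacobians without a zero mode. [folklore] -/
theorem re_eig_gt_of_numRange_shift {A S : Matrix ι ι ℝ} (hS : S.PosDef) {ν₀ : ℝ}
    (hH : (S * A + (S * A)ᵀ - (2 * ν₀) • S).PosDef)
    {μ : ℂ} {x : ι → ℂ} (hx : x ≠ 0) (hAx : A.map ((↑) : ℝ → ℂ) *ᵥ x = μ • x) : ν₀ < μ.re := by
  -- shift: (A + 1) x = (μ + 1) x, and μ + 1 ≠ 0 unless μ = −1; use the shift `t = |μ.re| + |ν₀| + 1`... simpler: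
  -- two shifts cover all cases: t = 1 unless μ = −1, else t = 2.
  have key : ∀ t : ℝ, μ + t ≠ 0 → ν₀ < μ.re := by
    intro t ht
    have hAt : (A + t • (1 : Matrix ι ι ℝ)).map ((↑) : ℝ → ℂ) *ᵥ x = (μ + t) • x := by
      have : (A + t • (1 : Matrix ι ι ℝ)).map ((↑) : ℝ → ℂ)
          = A.map ((↑) : ℝ → ℂ) + (t : ℂ) • (1 : Matrix ι ι ℂ) := by
        ext a b
        simp only [Matrix.map_apply, Matrix.add_apply, Matrix.smul_apply, Matrix.one_apply, smul_eq_mul]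
        split_ifs <;> push_cast <;> ring
      rw [this, Matrix.add_mulVec, Matrix.smul_mulVec, Matrix.one_mulVec, hAx, add_smul]
    have hHt : (S * (A + t • (1 : Matrix ι ι ℝ)) + (S * (A + t • (1 : Matrix ι ι ℝ)))ᵀ
        - (2 * (ν₀ + t)) • S + (0 : ℝ) • Matrix.vecMulVec (0 : ι → ℝ) 0).PosDef := by
      have hSt : Sᵀ = S := by
        have h := hS.isHermitian
        rw [Matrix.IsHermitian, Matrix.conjTranspose_eq_transpose_of_trivial] at h
        exact h
      have : S * (A + t • (1 : Matrix ι ι ℝ)) + (S * (A + t • (1 : Matrix ι ι ℝ)))ᵀ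
          - (2 * (ν₀ + t)) • S + (0 : ℝ) • Matrix.vecMulVec (0 : ι → ℝ) 0
          = S * A + (S * A)ᵀ - (2 * ν₀) • S := by
        rw [zero_smul, add_zero, Matrix.mul_add, Matrix.mul_smul, Matrix.mul_one, Matrix.transpose_add,
          Matrix.transpose_smul, hSt]
        ext a b
        simp only [Matrix.add_apply, Matrix.sub_apply, Matrix.smul_apply, smul_eq_mul]
        ring
      rw [this]; exact hH
    have hw0 : Matrix.vecMul (0 : ι → ℝ) (A + t • (1 : Matrix ι ι ℝ)) = 0 := Matrix.zero_vecMul _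
    rcases re_eig_gt_of_numRange hS hw0 hHt hx hAt with h0 | hre
    · exact absurd h0 ht
    · have h' := hre
      simp only [Complex.add_re, Complex.ofReal_re] at h'
      linarith
  by_cases h1 : μ + (1 : ℝ) = 0
  · refine key 2 ?_
    intro h2
    have : ((1 : ℝ) : ℂ) = ((2 : ℝ) : ℂ) := by linear_combination h1 - h2
    norm_num at this
  · exact key 1 h1

end Deflate

/-- Reindexing plumbing for the `2n × 2n` block certificate: a matrix on `Fin m ⊕ Fin m` whose entries are
those of a positive semidefinite matrix on `Fin (m + m)` along `finSumFinEquiv` is positive semidefinite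
(`PosSemidef.submatrix`). Lets instance files certify `[[2κ·S, K], [Kᵀ, 2κ·S]]` with the `Fin`-indexed
integer Gram route. [folklore] -/
theorem posSemidef_of_finSumFinEquiv {m : ℕ} {X : Matrix (Fin m ⊕ Fin m) (Fin m ⊕ Fin m) ℝ}
    {Y : Matrix (Fin (m + m)) (Fin (m + m)) ℝ} (hY : Y.PosSemidef)
    (h : ∀ i j, X i j = Y (finSumFinEquiv i) (finSumFinEquiv j)) : X.PosSemidef := by
  have hX : X = Y.submatrix finSumFinEquiv finSumFinEquiv := by
    ext i j; exact h i j
  rw [hX]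
  exact hY.submatrix _

/-! ## §1 The classical network-reduced model with transfer conductances, uniform damping ratio -/

namespace ClassicalSwing

variable {n : ℕ} (p : ClassicalSwing n)

/-- The DEFLATED Jacobian block `A₊(δ, z) = M⁻¹L(δ) + 1 zᵀ` (Brauer shift of the synchronous mode to
`γ = Σ z_j`; `z` is certificate data). [folklore] -/
def AblockDefl (δ z : Fin n → ℝ) : Matrix (Fin n) (Fin n) ℝ :=
  p.Ablock δ + Matrix.vecMulVec (fun _ => (1 : ℝ)) z

/-- **Certified small-signal decay rate, DEFLATED numerical-range form (lossy network, complex pencils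
admitted, any positive definite `S`, no left null vector).** Uniform damping ratio `D_i = d·M_i` (`M_i > 0`),
any `G`, `B`; data `z` with `ν₀ < Σ z_j`, `S ≻ 0`, `S A₊ + (S A₊)ᵀ − 2ν₀·S ≻ 0`,
`[[2κ·S, K], [Kᵀ, 2κ·S]] ⪰ 0` with `K = S A₊ − (S A₊)ᵀ` (`A₊ = M⁻¹L(δ) + 1 zᵀ`), `d > 2r`,
`κ² ≤ (d − 2r)²·(ν₀ + r² − d r)` ⇒ every complex eigenpair `(z, [x; y])` of `J(δ)` is synchronous
(`L(δ) x = 0`) or has `Re z < −r`. CERTIFIED: about the matrix `J(δ)`; MODELLED: MV-2 (lossy Kron reduction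
KEPT) + MV-λ [cite: SauerPai1998, §6.10]. No stability sentence. -/
theorem eig_re_lt_neg_of_deflate (hM : ∀ i, 0 < p.M i) {d : ℝ} (hD : ∀ i, p.D i = d * p.M i)
    (δ z : Fin n → ℝ) {S K : Matrix (Fin n) (Fin n) ℝ} {ν₀ κ r : ℝ} (hS : S.PosDef)
    (hγ : ν₀ < ∑ j, z j)
    (hH : (S * p.AblockDefl δ z + (S * p.AblockDefl δ z)ᵀ - (2 * ν₀) • S).PosDef)
    (hK : K = S * p.AblockDefl δ z - (S * p.AblockDefl δ z)ᵀ)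
    (hB : (Matrix.fromBlocks ((2 * κ) • S) K Kᵀ ((2 * κ) • S)).PosSemidef)
    (hd : 0 < d - 2 * r) (hκ : κ ^ 2 ≤ (d - 2 * r) ^ 2 * (ν₀ + r ^ 2 - d * r))
    {zz : ℂ} {v : Fin n ⊕ Fin n → ℂ} (hv : v ≠ 0)
    (hJ : (p.jacMatrix δ).map ((↑) : ℝ → ℂ) *ᵥ v = zz • v) :
    (p.PeJac δ).map ((↑) : ℝ → ℂ) *ᵥ (v ∘ Sum.inl) = 0 ∨ zz.re < -r := by
  have hM' : ∀ i, p.M i ≠ 0 := fun i => (hM i).ne'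
  rw [p.jacMatrix_eq_secondOrderJac hD hM' δ, secondOrderJac_map_ofReal] at hJ
  have hx := secondOrderJac_eig_fst_ne_zero hJ hv
  have hA := ((secondOrderJac_eig_iff _ _ zz v).1 hJ).2
  set μ : ℂ := -(zz ^ 2 + (d : ℂ) * zz) with hμdef
  have hAμ : (p.Ablock δ).map ((↑) : ℝ → ℂ) *ᵥ (v ∘ Sum.inl) = μ • (v ∘ Sum.inl) := by
    rw [hA, hμdef, neg_smul]
  by_cases hμ0 : μ = 0
  · left
    rw [← p.Ablock_map_mulVec_eq_zero_iff hM', hAμ, hμ0, zero_smul]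
  right
  have hq : zz ^ 2 + (d : ℂ) * zz + μ = 0 := by rw [hμdef]; ring
  -- real and imaginary parts of μ
  have hregion : μ.im ^ 2 < (d - 2 * r) ^ 2 * (μ.re + r ^ 2 - d * r) := by
    have hpos : 0 < (d - 2 * r) ^ 2 := by positivity
    by_cases hμγ : μ = ((∑ j, z j : ℝ) : ℂ)
    · -- the deflation value itself: real, `> ν₀`
      have him : μ.im = 0 := by rw [hμγ]; simp
      have hre : ν₀ < μ.re := by rw [hμγ]; simpa using hγ
      rw [him]
      nlinarith [sq_nonneg κ]
    · obtain ⟨x', hx', hAx'⟩ :=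
        exists_eig_deflate (p.Ablock_rowsum δ) z hx hAμ hμ0 hμγ
      have hAx'' : (p.AblockDefl δ z).map ((↑) : ℝ → ℂ) *ᵥ x' = μ • x' := hAx'
      have hH' : (S * p.AblockDefl δ z + (S * p.AblockDefl δ z)ᵀ - (2 * ν₀) • S
          + (0 : ℝ) • Matrix.vecMulVec (0 : Fin n → ℝ) 0).PosDef := by
        simpa using hH
      have hw0 : Matrix.vecMul (0 : Fin n → ℝ) (p.AblockDefl δ z) = 0 := Matrix.zero_vecMul _
      rcases re_eig_gt_of_numRange hS hw0 hH' hx' hAx'' with h0 | hre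
      · exact absurd h0 hμ0
      have him := im_eig_le_of_numRange hS hK hB hx' hAx''
      have h1 : μ.im ^ 2 ≤ κ ^ 2 := by
        rw [← sq_abs]
        exact pow_le_pow_left₀ (abs_nonneg _) him 2
      have h2 : (d - 2 * r) ^ 2 * (ν₀ + r ^ 2 - d * r) < (d - 2 * r) ^ 2 * (μ.re + r ^ 2 - d * r) := by
        nlinarith
      linarith
  exact quadratic_re_lt_neg_of_region hd hregion hq

/-- **The synchronous mode is the uniform angle shift (deflated real-part certificate, `ν₀ ≥ 0`,
`Σ z_j ≠ 0`).** `L(δ) x = 0` forces `x` constant: `y = x − (zᵀx/Σz)·1` has `A₊ y = 0`, so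
`y*(S A₊ + (S A₊)ᵀ − 2ν₀ S)y = −2ν₀·y*Sy ≤ 0`, forcing `y = 0`. [folklore] -/
theorem PeJac_ker_const_of_deflate (hM : ∀ i, p.M i ≠ 0) (δ z : Fin n → ℝ)
    {S : Matrix (Fin n) (Fin n) ℝ} {ν₀ : ℝ} (hS : S.PosDef) (hν₀ : 0 ≤ ν₀) (hγ : ∑ j, z j ≠ 0)
    (hH : (S * p.AblockDefl δ z + (S * p.AblockDefl δ z)ᵀ - (2 * ν₀) • S).PosDef)
    {x : Fin n → ℂ} (hL : (p.PeJac δ).map ((↑) : ℝ → ℂ) *ᵥ x = 0) : ∃ c : ℂ, x = fun _ => c := by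
  classical
  have hAx : (p.Ablock δ).map ((↑) : ℝ → ℂ) *ᵥ x = 0 := (p.Ablock_map_mulVec_eq_zero_iff hM δ x).2 hL
  set γ : ℂ := ((∑ j, z j : ℝ) : ℂ) with hγdef
  have hγ0 : γ ≠ 0 := by rw [hγdef]; exact_mod_cast hγ
  set t : ℂ := ∑ j, (z j : ℂ) * x j with htdef
  set c : ℂ := t / γ with hcdef
  refine ⟨c, ?_⟩
  set y : Fin n → ℂ := fun i => x i - c with hydef
  -- A₊ y = 0
  have hγsum : (∑ j, (z j : ℂ)) = γ := by rw [hγdef]; push_cast; rfl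
  have hAy : (p.AblockDefl δ z).map ((↑) : ℝ → ℂ) *ᵥ y = (0 : ℂ) • y := by
    rw [zero_smul]
    funext i
    rw [map_ofReal_mulVec_apply]
    simp only [AblockDefl, Matrix.add_apply, Matrix.vecMulVec_apply, one_mul, Pi.zero_apply]
    push_cast
    have h1 : ∑ j, ((p.Ablock δ i j : ℂ) + (z j : ℂ)) * (x j - c)
        = (∑ j, (p.Ablock δ i j : ℂ) * x j) - c * (∑ j, (p.Ablock δ i j : ℂ)) + t
          - c * ∑ j, (z j : ℂ) := by
      rw [htdef, Finset.mul_sum, Finset.mul_sum, ← Finset.sum_sub_distrib, ← Finset.sum_add_distrib,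
        ← Finset.sum_sub_distrib]
      refine Finset.sum_congr rfl fun j _ => ?_
      ring
    have h2 : (∑ j, (p.Ablock δ i j : ℂ) * x j) = 0 := by
      have := congr_fun hAx i
      rwa [map_ofReal_mulVec_apply] at this
    have h3 : (∑ j, (p.Ablock δ i j : ℂ)) = 0 := by exact_mod_cast p.Ablock_rowsum δ i
    rw [h1, h2, h3, hγsum, hcdef]
    field_simp
    ring
  by_contra hxc
  have hy : y ≠ 0 := by
    intro hy0
    apply hxc
    funext i
    have := congr_fun hy0 i
    simp only [hydef, Pi.zero_apply, sub_eq_zero] at this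
    exact this
  have hN : star y ⬝ᵥ ((S * p.AblockDefl δ z).map ((↑) : ℝ → ℂ) *ᵥ y) = 0 := by
    rw [star_dotProduct_mul_map_mulVec_of_eig hAy, zero_mul]
  have hNT : star y ⬝ᵥ ((S * p.AblockDefl δ z)ᵀ.map ((↑) : ℝ → ℂ) *ᵥ y) = 0 := by
    rw [star_dotProduct_transpose_map_mulVec, hN, map_zero]
  set H : Matrix (Fin n) (Fin n) ℝ := S * p.AblockDefl δ z + (S * p.AblockDefl δ z)ᵀ - (2 * ν₀) • S
    with hHdef
  have hsplit : H.map ((↑) : ℝ → ℂ) = (S * p.AblockDefl δ z).map ((↑) : ℝ → ℂ)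
      + (S * p.AblockDefl δ z)ᵀ.map ((↑) : ℝ → ℂ) - ((2 * ν₀ : ℝ) : ℂ) • S.map ((↑) : ℝ → ℂ) := by
    ext a b
    simp [hHdef, Matrix.add_apply, Matrix.sub_apply, Matrix.smul_apply]
  have hpos : 0 < star y ⬝ᵥ (H.map ((↑) : ℝ → ℂ) *ᵥ y) := dotProduct_map_ofReal_mulVec_pos hH hy
  have hq : 0 < star y ⬝ᵥ (S.map ((↑) : ℝ → ℂ) *ᵥ y) := dotProduct_map_ofReal_mulVec_pos hS hy
  rw [hsplit, Matrix.sub_mulVec, Matrix.add_mulVec, Matrix.smul_mulVec, dotProduct_sub, dotProduct_add,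
    dotProduct_smul, hN, hNT, smul_eq_mul, add_zero, zero_sub] at hpos
  obtain ⟨hqre, hqim⟩ := Complex.pos_iff.1 hq
  set q := star y ⬝ᵥ (S.map ((↑) : ℝ → ℂ) *ᵥ y)
  have hqC : q = (q.re : ℂ) := Complex.ext (by simp) (by simp [← hqim])
  rw [hqC, ← Complex.ofReal_mul, ← Complex.ofReal_neg] at hpos
  have h := Complex.zero_lt_real.1 hpos
  nlinarith

end ClassicalSwing

/-! ## §2 Reading on the droop-inverter microgrid (common power-filter constant, lossy lines) -/

namespace DroopMicrogrid

variable {n : ℕ} (mg : DroopMicrogrid n)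

/-- **Certified small-signal decay rate for an `n`-unit droop microgrid with a COMMON power-filter time
constant `τ` and LOSSY lines, deflated numerical-range form** (complex pencils admitted; `d = 1/τ`).
CERTIFIED: about the matrix `J(δ)` of the MODEL; MODELLED: MV-6N with lossy lines
[cite: KunduEtAl2019, eqs. (4a)–(4b), (5a)] [cite: SchifferEtAl2014, Remark 3.3]. No stability sentence. -/
theorem eig_re_lt_neg_of_commonFilter_deflate (hk : ∀ i, 0 < mg.kP i) {τ : ℝ} (hτ0 : 0 < τ)
    (hτ : ∀ i, mg.τP i = τ) (V δ z : Fin n → ℝ) {S K : Matrix (Fin n) (Fin n) ℝ} {ν₀ κ r : ℝ}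
    (hS : S.PosDef) (hγ : ν₀ < ∑ j, z j)
    (hH : (S * (mg.toClassicalSwing V).AblockDefl δ z + (S * (mg.toClassicalSwing V).AblockDefl δ z)ᵀ
      - (2 * ν₀) • S).PosDef)
    (hK : K = S * (mg.toClassicalSwing V).AblockDefl δ z - (S * (mg.toClassicalSwing V).AblockDefl δ z)ᵀ)
    (hB : (Matrix.fromBlocks ((2 * κ) • S) K Kᵀ ((2 * κ) • S)).PosSemidef)
    (hd : 0 < 1 / τ - 2 * r) (hκ : κ ^ 2 ≤ (1 / τ - 2 * r) ^ 2 * (ν₀ + r ^ 2 - 1 / τ * r))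
    {zz : ℂ} {v : Fin n ⊕ Fin n → ℂ} (hv : v ≠ 0)
    (hJ : ((mg.toClassicalSwing V).jacMatrix δ).map ((↑) : ℝ → ℂ) *ᵥ v = zz • v) :
    ((mg.toClassicalSwing V).PeJac δ).map ((↑) : ℝ → ℂ) *ᵥ (v ∘ Sum.inl) = 0 ∨ zz.re < -r := by
  have hk' : ∀ i, mg.kP i ≠ 0 := fun i => (hk i).ne'
  have hM : ∀ i, 0 < (mg.toClassicalSwing V).M i := fun i => by
    simp only [toClassicalSwing, hτ i]
    exact div_pos hτ0 (hk i)
  exact (mg.toClassicalSwing V).eig_re_lt_neg_of_deflate hM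
    (mg.toClassicalSwing_uniformDamping hk' hτ0.ne' hτ V) δ z hS hγ hH hK hB hd hκ hv hJ

end DroopMicrogrid

end Summit.Ventures.GridStability.Models

end
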